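import Literature.MathematicalPhysics.QuantumLattice.KomaTasakiSSB
import Mathlib.Algebra.Order.Ring.Pow
import Mathlib.Data.Nat.Choose.Sum
import HarnessLib

/-!
# Koma–Tasaki 1994, Theorem 2.3 — proof (`theorem_2_3_holds`)

Discharges the named fact `theorem_2_3` of `KomaTasakiSSB.lean`:

* T. Koma, H. Tasaki, *Symmetry breaking and finite-size effects in quantum many-body systems*,
  J. Stat. Phys. **76** (1994) 745–803, arXiv:cond-mat/9708132 (`KomaTasaki1994`), Theorem 2.3,
  proved in §4 ("Proof of Theorem 2.3" / "Proof of first theorem") with its single lemma,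
  Lemma 4.1 (the growth bound `⟨(Q*)^{M-k} Q^{M-k}⟩ / ⟨(Q*)^M Q^M⟩ ≤ (μ o N)^{-2k}`, (QQBound)
  in the arXiv source).  Source read: arXiv:cond-mat/9708132, §2.3 (statement) and §4 (proof).

## The argument (KT §4), as formalised

Fix `M ≥ 1` and put `ψ = (O⁺)^M Φ`.  For each site `x` split `O⁺ = R_x + Q_x`,
`R_x = Σ_{y ∈ S_x} o⁺_y`, `Q_x = Σ_{y ∉ S_x} o⁺_y` (`o⁺_y = o^{(1)}_y + i o^{(2)}_y`), so that
`[R_x, Q_x] = 0` (hypothesis i)), `[h_x, Q_x] = 0` (ii)), `‖R_x‖ ≤ 2 o r` (ii), iii)).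

* *Growth lemma* (KT Lemma 4.1): `a_m = ‖Q_x^m Φ‖²` satisfies `a_m ≥ (μ o N)² a_{m-1}` for
  `1 ≤ m ≤ M`.  Ingredients: `a_1 ≥ 2(μ o N)² − 2o²N − 8o²rN` (long-range order (2.17) in BOTH
  components, `‖[O^{(1)}, O^{(2)}]‖ ≤ 2o²N` by i), and `‖R_x Φ‖ ≤ 2or`); the Cauchy–Schwarz
  recursion `a_{m-1}² ≤ a_{m-2}(a_m + ‖[Q_x, Q_x^*]‖ a_{m-1})` with `‖[Q_x, Q_x^*]‖ ≤ 8o²N`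
  (the commutator localises to `Σ_y [o⁺_y, o⁻_y]` by i)); and the size conditions (2.20)–(2.21)
  in the form `8r + 2 + 8M ≤ μ²N`.
* *Expansion* `(R_x + Q_x)^M = Σ_k C(M,k) R_x^k Q_x^{M-k}` (binomial theorem for commuting
  operators): `‖ψ − Q_x^M Φ‖ ≤ ‖Q_x^M Φ‖ (u − 1)` and
  `‖h_x ψ − (O⁺)^M h_x Φ‖ ≤ 2h ‖Q_x^M Φ‖ (u − 1)`, `u = (1 + 2r/(μN))^M`.
* *Assembly*: `⟨ψ, Hψ⟩ − E‖ψ‖² = Σ_x ⟨ψ, h_x ψ − (O⁺)^M h_x Φ⟩` (only `HΦ = EΦ` is used), hence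
  `|⟨ψ,Hψ⟩ − E‖ψ‖²| ≤ N ‖ψ‖² · 2h(u−1)/(2−u)`, and Bernoulli's inequality gives
  `u ≤ 1/(1 − 2rM/(μN))`, `2rM/(μN) ≤ μ/4 ≤ 1/4`, so `(u−1)/(2−u) ≤ 4rM/(μN)`.

This yields (2.22) with the constant `c₁(h, r, μ) = 8 h r / μ`.  KT's printed constant is
`16 r h (e^{μ/2} − e^{μ/4}) / (μ²(2 − e^{μ/2}))`; the fact `theorem_2_3` only asserts the
existence of some `c₁(h, r, μ)`, and we use Cauchy–Schwarz on `⟨ψ, ξ_x⟩` as a whole instead of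
KT's term-by-term double sums, which is where the constants differ.  Negative `M`
(`(O⁺)^M := (O⁻)^{|M|}`) is reduced to positive `M` for the *mirror system*
`o^{(2)} ↦ −o^{(2)}`, `C ↦ −C`, which satisfies i)–iv) with the same constants and has
`O⁺_{mirror} = O⁻`.

Nothing here uses finite-dimensionality of `E` or the `C`-eigenvector hypothesis.
-/

noncomputable section

open Complex Finset
open scoped InnerProductSpace ComplexConjugate

namespace Literature.MathematicalPhysics.QuantumLattice.KomaTasaki

universe u v

variable {Λ : Type u} [Fintype Λ] {E : Type v} [NormedAddCommGroup E] [InnerProductSpace ℂ E]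

/-! ### Generic operator lemmas -/

section Generic

omit [Fintype Λ]

/-- `‖T^n v‖ ≤ ρ^n ‖v‖` when `‖T‖ ≤ ρ`. [folklore] -/
theorem norm_pow_apply_le {T : E →L[ℂ] E} {ρ : ℝ} (hT : ‖T‖ ≤ ρ) (v : E) (n : ℕ) :
    ‖(T ^ n) v‖ ≤ ρ ^ n * ‖v‖ := by
  induction n with
  | zero => simp
  | succ n ih =>
    rw [pow_succ', mul_apply_eq_comp, pow_succ']
    calc ‖T ((T ^ n) v)‖ ≤ ‖T‖ * ‖(T ^ n) v‖ := T.le_opNorm _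
      _ ≤ ρ * (ρ ^ n * ‖v‖) := by
          have hρ : 0 ≤ ρ := (norm_nonneg _).trans hT
          gcongr
      _ = ρ * ρ ^ n * ‖v‖ := by ring

/-- `‖T^n‖ ≤ ρ^n` when `‖T‖ ≤ ρ`. [folklore] -/
theorem norm_pow_le_of_le {T : E →L[ℂ] E} {ρ : ℝ} (hT : ‖T‖ ≤ ρ) (n : ℕ) : ‖T ^ n‖ ≤ ρ ^ n :=
  ContinuousLinearMap.opNorm_le_bound _ (pow_nonneg ((norm_nonneg _).trans hT) n)
    (norm_pow_apply_le hT · n)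

/-- `‖[A, B]‖ ≤ 2 ‖A‖ ‖B‖`. [folklore] -/
theorem norm_comm_le (A B : E →L[ℂ] E) : ‖A * B - B * A‖ ≤ 2 * ‖A‖ * ‖B‖ :=
  calc ‖A * B - B * A‖ ≤ ‖A * B‖ + ‖B * A‖ := norm_sub_le _ _
    _ ≤ ‖A‖ * ‖B‖ + ‖B‖ * ‖A‖ := add_le_add (norm_mul_le _ _) (norm_mul_le _ _)
    _ = 2 * ‖A‖ * ‖B‖ := by ring

/-- The commutator of two sums over the same index set whose off-diagonal terms commute is the
sum of the diagonal commutators: `[Σ A_i, Σ B_j] = Σ_i [A_i, B_i]`. [folklore] -/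
theorem sum_mul_sum_sub_sum_mul_sum {R : Type*} [Ring R] {ι : Type*} (s : Finset ι)
    (A B : ι → R) (h : ∀ i ∈ s, ∀ j ∈ s, i ≠ j → A i * B j = B j * A i) :
    (∑ i ∈ s, A i) * (∑ i ∈ s, B i) - (∑ i ∈ s, B i) * (∑ i ∈ s, A i) =
      ∑ i ∈ s, (A i * B i - B i * A i) := by
  have h2 : (∑ i ∈ s, B i) * (∑ i ∈ s, A i) = ∑ i ∈ s, ∑ j ∈ s, B j * A i := by
    rw [Finset.sum_mul_sum, Finset.sum_comm]
  rw [Finset.sum_mul_sum, h2, ← Finset.sum_sub_distrib]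
  refine Finset.sum_congr rfl fun i hi => ?_
  rw [← Finset.sum_sub_distrib]
  exact Finset.sum_eq_single_of_mem i hi fun j hj hji =>
    sub_eq_zero.mpr (h i hi j hj (Ne.symm hji))

/-- `|⟪v, T v⟫| ≤ ‖T‖ ‖v‖²`. [folklore] -/
theorem norm_inner_apply_le (T : E →L[ℂ] E) (v : E) : ‖⟪v, T v⟫_ℂ‖ ≤ ‖T‖ * ‖v‖ ^ 2 :=
  calc ‖⟪v, T v⟫_ℂ‖ ≤ ‖v‖ * ‖T v‖ := norm_inner_le_norm _ _
    _ ≤ ‖v‖ * (‖T‖ * ‖v‖) := by gcongr; exact T.le_opNorm v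
    _ = ‖T‖ * ‖v‖ ^ 2 := by ring

/-- `‖T v‖² = re ⟪T v, T v⟫`. [folklore] -/
theorem norm_sq_eq_re_inner_self (v : E) : ‖v‖ ^ 2 = (⟪v, v⟫_ℂ).re := by
  rw [← inner_self_eq_norm_sq (𝕜 := ℂ) v]; rfl

end Generic

/-! ### The mirror system `o^{(2)} ↦ -o^{(2)}`, `C ↦ -C` -/

namespace U1System

variable (sys : U1System Λ E)

omit [Fintype Λ] in
/-- A symmetric operator stays symmetric under negation. [folklore] -/
theorem isSymmetric_neg {T : E →L[ℂ] E} (hT : (T : E →ₗ[ℂ] E).IsSymmetric) :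
    ((-T : E →L[ℂ] E) : E →ₗ[ℂ] E).IsSymmetric := by
  intro φ ψ
  simp only [ContinuousLinearMap.toLinearMap_neg, LinearMap.neg_apply, inner_neg_left, inner_neg_right]
  exact congrArg Neg.neg (hT φ ψ)

/-- **The mirror system** (KT §4, first line: "we prove Theorem 2.3 for `M > 0`"; the case
`M < 0` is the case `M > 0` for this system): the same local Hamiltonians, `o^{(1)}` unchanged,
`o^{(2)} ↦ -o^{(2)}`, `C ↦ -C`.  It satisfies (2.12)–(2.14) and i)–iii) with the same
`S_x, r, h, o`, and its raising operator is the original lowering operator `O⁻`.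
[cite: KomaTasaki1994, §4] -/
def mirror : U1System Λ E where
  h := sys.h
  o := ![sys.o 0, fun x => -sys.o 1 x]
  C := -sys.C
  supp := sys.supp
  r := sys.r
  hbar := sys.hbar
  obar := sys.obar
  isSymmetric_h := sys.isSymmetric_h
  isSymmetric_o := by
    refine Fin.forall_fin_two.2 ⟨fun x => ?_, fun x => ?_⟩
    · simpa using sys.isSymmetric_o 0 x
    · simpa using isSymmetric_neg (sys.isSymmetric_o 1 x)
  isSymmetric_C := isSymmetric_neg sys.isSymmetric_C
  commute_hamiltonian_C := sys.commute_hamiltonian_C.neg_right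
  order_zero_C := by
    have h0 := sys.order_zero_C
    simp only [Matrix.cons_val_zero, Matrix.cons_val_one, Finset.sum_neg_distrib,
      mul_neg, neg_mul, smul_neg, neg_neg]
    have e : -((∑ x, sys.o 0 x) * sys.C) - -(sys.C * ∑ x, sys.o 0 x) =
        -((∑ x, sys.o 0 x) * sys.C - sys.C * ∑ x, sys.o 0 x) := by abel
    rw [e, h0, neg_neg]
  order_one_C := by
    have h1 := sys.order_one_C
    simp only [Matrix.cons_val_zero, Matrix.cons_val_one, Finset.sum_neg_distrib,
      mul_neg, neg_mul, neg_neg]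
    exact h1
  commute_o := by
    intro x y hxy
    refine Fin.forall_fin_two.2 ⟨Fin.forall_fin_two.2 ⟨?_, ?_⟩, Fin.forall_fin_two.2 ⟨?_, ?_⟩⟩
    · simpa using sys.commute_o x y hxy 0 0
    · simpa using (sys.commute_o x y hxy 0 1).neg_right
    · simpa using (sys.commute_o x y hxy 1 0).neg_left
    · simpa using ((sys.commute_o x y hxy 1 1).neg_left).neg_right
  commute_h_o := by
    intro x y hy
    refine Fin.forall_fin_two.2 ⟨?_, ?_⟩
    · simpa using sys.commute_h_o x y hy 0
    · simpa using (sys.commute_h_o x y hy 1).neg_right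
  card_supp_le := sys.card_supp_le
  two_le_r := sys.two_le_r
  norm_h_le := sys.norm_h_le
  norm_o_le := by
    refine Fin.forall_fin_two.2 ⟨fun x => ?_, fun x => ?_⟩
    · simpa using sys.norm_o_le 0 x
    · simpa [norm_neg] using sys.norm_o_le 1 x
  obar_pos := sys.obar_pos

/-- The mirror system has the same local Hamiltonians. [cite: KomaTasaki1994, §4] -/
@[simp] theorem mirror_h : sys.mirror.h = sys.h := rfl

/-- The mirror system has the same range `r`. [cite: KomaTasaki1994, §4] -/
@[simp] theorem mirror_r : sys.mirror.r = sys.r := rfl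

/-- The mirror system has the same bound `h`. [cite: KomaTasaki1994, §4] -/
@[simp] theorem mirror_hbar : sys.mirror.hbar = sys.hbar := rfl

/-- The mirror system has the same bound `o`. [cite: KomaTasaki1994, §4] -/
@[simp] theorem mirror_obar : sys.mirror.obar = sys.obar := rfl

/-- The mirror system has the same supports `S_x`. [cite: KomaTasaki1994, §4] -/
@[simp] theorem mirror_supp : sys.mirror.supp = sys.supp := rfl

/-- The mirror system has generator `-C`. [cite: KomaTasaki1994, §4] -/
@[simp] theorem mirror_C : sys.mirror.C = -sys.C := rfl

/-- The mirror system has the same `o^{(1)}_x`. [cite: KomaTasaki1994, §4] -/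
@[simp] theorem mirror_o_zero (x : Λ) : sys.mirror.o 0 x = sys.o 0 x := rfl

/-- The mirror system has `-o^{(2)}_x` as second density. [cite: KomaTasaki1994, §4] -/
@[simp] theorem mirror_o_one (x : Λ) : sys.mirror.o 1 x = -sys.o 1 x := rfl

/-- The mirror system has the same Hamiltonian. [cite: KomaTasaki1994, §4] -/
@[simp] theorem mirror_hamiltonian : sys.mirror.hamiltonian = sys.hamiltonian := rfl

/-- The mirror system has the same first order operator. [cite: KomaTasaki1994, §4] -/
@[simp] theorem mirror_order_zero : sys.mirror.order 0 = sys.order 0 := rfl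

/-- The mirror system has the negated second order operator. [cite: KomaTasaki1994, §4] -/
@[simp] theorem mirror_order_one : sys.mirror.order 1 = -sys.order 1 := by
  simp only [order, mirror_o_one, Finset.sum_neg_distrib]

/-- The raising operator of the mirror system is `O⁻`. [cite: KomaTasaki1994, §4] -/
@[simp] theorem mirror_orderPlus : sys.mirror.orderPlus = sys.orderMinus := by
  rw [orderPlus, orderMinus, mirror_order_zero, mirror_order_one, smul_neg, sub_eq_add_neg]

end U1System

/-- The state `Φ` satisfies iv) for the mirror system as well. [cite: KomaTasaki1994, §4] -/
theorem IsLROEigenstate.mirror {sys : U1System Λ E} {Φ : E} {EΛ μ : ℝ}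
    (hΦ : IsLROEigenstate sys Φ EΛ μ) : IsLROEigenstate sys.mirror Φ EΛ μ where
  norm_eq_one := hΦ.norm_eq_one
  eigen_hamiltonian := by rw [U1System.mirror_hamiltonian]; exact hΦ.eigen_hamiltonian
  eigen_C := by
    obtain ⟨c, hc⟩ := hΦ.eigen_C
    exact ⟨-c, by simp [hc]⟩
  mu_pos := hΦ.mu_pos
  mu_le_one := hΦ.mu_le_one
  lro := by simpa using hΦ.lro
  lro_eq := by simpa using hΦ.lro_eq

/-! ### Local raising operators and the splitting `O⁺ = R_x + Q_x` (KT §4) -/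

namespace U1System

variable (sys : U1System Λ E)

/-- The local raising operator `o⁺_y = o^{(1)}_y + i o^{(2)}_y` (KT §4, `O⁺ = Σ_y o⁺_y`).
[cite: KomaTasaki1994, §4] -/
def oPlus (y : Λ) : E →L[ℂ] E := sys.o 0 y + I • sys.o 1 y

/-- The local lowering operator `o⁻_y = o^{(1)}_y - i o^{(2)}_y = (o⁺_y)^*`.
[cite: KomaTasaki1994, §4] -/
def oMinus (y : Λ) : E →L[ℂ] E := sys.o 0 y - I • sys.o 1 y

/-- `R_x = Σ_{y ∈ S_x} o⁺_y`, the part of `O⁺` that may fail to commute with `h_x` (KT §4).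
[cite: KomaTasaki1994, §4] -/
def localR (x : Λ) : E →L[ℂ] E := ∑ y ∈ sys.supp x, sys.oPlus y

/-- `Q_x = Σ_{y ∉ S_x} o⁺_y`, the part of `O⁺` commuting with `h_x` (KT §4).
[cite: KomaTasaki1994, §4] -/
def localQ [DecidableEq Λ] (x : Λ) : E →L[ℂ] E := ∑ y ∈ (sys.supp x)ᶜ, sys.oPlus y

/-- `Q_x^* = Σ_{y ∉ S_x} o⁻_y`, the adjoint of `Q_x` (KT §4). [cite: KomaTasaki1994, §4] -/
def localQadj [DecidableEq Λ] (x : Λ) : E →L[ℂ] E := ∑ y ∈ (sys.supp x)ᶜ, sys.oMinus y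

/-- `O⁺ = Σ_y o⁺_y`. [cite: KomaTasaki1994, §4] -/
theorem orderPlus_eq_sum_oPlus : sys.orderPlus = ∑ y, sys.oPlus y := by
  simp only [orderPlus, order, oPlus, Finset.sum_add_distrib, Finset.smul_sum]

/-- `O⁺ = R_x + Q_x`. [cite: KomaTasaki1994, §4] -/
theorem orderPlus_eq_localR_add_localQ [DecidableEq Λ] (x : Λ) :
    sys.orderPlus = sys.localR x + sys.localQ x := by
  rw [orderPlus_eq_sum_oPlus, localR, localQ, Finset.sum_add_sum_compl]

/-- `o⁺_y` and `o⁺_z` commute for `y ≠ z` (hypothesis i)). [cite: KomaTasaki1994, §2.3 i)] -/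
theorem commute_oPlus_oPlus {y z : Λ} (h : y ≠ z) : Commute (sys.oPlus y) (sys.oPlus z) := by
  have hc := sys.commute_o y z h
  refine Commute.add_left (Commute.add_right (hc 0 0) ((hc 0 1).smul_right I))
    (Commute.add_right ((hc 1 0).smul_left I) (((hc 1 1).smul_left I).smul_right I))

/-- `o⁺_y` and `o⁻_z` commute for `y ≠ z` (hypothesis i)). [cite: KomaTasaki1994, §2.3 i)] -/
theorem commute_oPlus_oMinus {y z : Λ} (h : y ≠ z) : Commute (sys.oPlus y) (sys.oMinus z) := by
  have hc := sys.commute_o y z h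
  refine Commute.add_left (Commute.sub_right (hc 0 0) ((hc 0 1).smul_right I))
    (Commute.sub_right ((hc 1 0).smul_left I) (((hc 1 1).smul_left I).smul_right I))

/-- `h_x` commutes with `o⁺_y` for `y ∉ S_x` (hypothesis ii)). [cite: KomaTasaki1994, §2.3 ii)] -/
theorem commute_h_oPlus {x y : Λ} (hy : y ∉ sys.supp x) : Commute (sys.h x) (sys.oPlus y) :=
  Commute.add_right (sys.commute_h_o x y hy 0) ((sys.commute_h_o x y hy 1).smul_right I)

/-- `[R_x, Q_x] = 0` (from i)). [cite: KomaTasaki1994, §4] -/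
theorem commute_localR_localQ [DecidableEq Λ] (x : Λ) :
    Commute (sys.localR x) (sys.localQ x) := by
  refine Commute.sum_left _ _ _ fun y hy => Commute.sum_right _ _ _ fun z hz => ?_
  refine sys.commute_oPlus_oPlus fun hyz => ?_
  rw [Finset.mem_compl] at hz
  exact hz (hyz ▸ hy)

/-- `[h_x, Q_x] = 0` (from ii)). [cite: KomaTasaki1994, §4] -/
theorem commute_h_localQ [DecidableEq Λ] (x : Λ) : Commute (sys.h x) (sys.localQ x) :=
  Commute.sum_right _ _ _ fun _ hy => sys.commute_h_oPlus (Finset.mem_compl.1 hy)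

/-- `‖o⁺_y‖ ≤ 2o` (from iii)). [cite: KomaTasaki1994, §4] -/
theorem norm_oPlus_le (y : Λ) : ‖sys.oPlus y‖ ≤ 2 * sys.obar := by
  calc ‖sys.oPlus y‖ ≤ ‖sys.o 0 y‖ + ‖I • sys.o 1 y‖ := norm_add_le _ _
    _ ≤ sys.obar + sys.obar := by
        rw [norm_smul, Complex.norm_I, one_mul]
        exact add_le_add (sys.norm_o_le 0 y) (sys.norm_o_le 1 y)
    _ = 2 * sys.obar := by ring

/-- `‖o⁻_y‖ ≤ 2o` (from iii)). [cite: KomaTasaki1994, §4] -/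
theorem norm_oMinus_le (y : Λ) : ‖sys.oMinus y‖ ≤ 2 * sys.obar := by
  calc ‖sys.oMinus y‖ ≤ ‖sys.o 0 y‖ + ‖I • sys.o 1 y‖ := norm_sub_le _ _
    _ ≤ sys.obar + sys.obar := by
        rw [norm_smul, Complex.norm_I, one_mul]
        exact add_le_add (sys.norm_o_le 0 y) (sys.norm_o_le 1 y)
    _ = 2 * sys.obar := by ring

/-- `‖R_x‖ ≤ 2 o r` (from ii), iii)). [cite: KomaTasaki1994, §4] -/
theorem norm_localR_le (x : Λ) : ‖sys.localR x‖ ≤ 2 * sys.obar * sys.r := by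
  calc ‖sys.localR x‖ ≤ ∑ y ∈ sys.supp x, ‖sys.oPlus y‖ := norm_sum_le _ _
    _ ≤ ∑ _y ∈ sys.supp x, 2 * sys.obar := Finset.sum_le_sum fun y _ => sys.norm_oPlus_le y
    _ = (sys.supp x).card * (2 * sys.obar) := by rw [Finset.sum_const, nsmul_eq_mul]
    _ ≤ sys.r * (2 * sys.obar) := by
        have h1 : ((sys.supp x).card : ℝ) ≤ sys.r := by exact_mod_cast sys.card_supp_le x
        have h2 : 0 ≤ 2 * sys.obar := by linarith [sys.obar_pos]
        exact mul_le_mul_of_nonneg_right h1 h2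
    _ = 2 * sys.obar * sys.r := by ring

/-- `‖O⁺‖ ≤ 2 o N` (from iii)). [cite: KomaTasaki1994, §4] -/
theorem norm_orderPlus_le : ‖sys.orderPlus‖ ≤ 2 * sys.obar * Fintype.card Λ := by
  rw [orderPlus_eq_sum_oPlus]
  calc ‖∑ y, sys.oPlus y‖ ≤ ∑ y, ‖sys.oPlus y‖ := norm_sum_le _ _
    _ ≤ ∑ _y : Λ, 2 * sys.obar := Finset.sum_le_sum fun y _ => sys.norm_oPlus_le y
    _ = 2 * sys.obar * Fintype.card Λ := by
        rw [Finset.sum_const, nsmul_eq_mul, Finset.card_univ]; ring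

/-- `⟪o⁺_y φ, ψ⟫ = ⟪φ, o⁻_y ψ⟫`: `o⁻_y` is the adjoint of `o⁺_y` (the `o^{(α)}_y` are
self-adjoint). [cite: KomaTasaki1994, §4] -/
theorem inner_oPlus_left (y : Λ) (φ ψ : E) :
    ⟪sys.oPlus y φ, ψ⟫_ℂ = ⟪φ, sys.oMinus y ψ⟫_ℂ := by
  have h0 : ⟪sys.o 0 y φ, ψ⟫_ℂ = ⟪φ, sys.o 0 y ψ⟫_ℂ := sys.isSymmetric_o 0 y φ ψ
  have h1 : ⟪sys.o 1 y φ, ψ⟫_ℂ = ⟪φ, sys.o 1 y ψ⟫_ℂ := sys.isSymmetric_o 1 y φ ψ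
  simp only [oPlus, oMinus, _root_.add_apply, _root_.sub_apply, _root_.smul_apply,
    inner_add_left, inner_sub_right, inner_smul_left, inner_smul_right, Complex.conj_I, h0, h1]
  ring

/-- `⟪Q_x φ, ψ⟫ = ⟪φ, Q_x^* ψ⟫`. [cite: KomaTasaki1994, §4] -/
theorem inner_localQ_left [DecidableEq Λ] (x : Λ) (φ ψ : E) :
    ⟪sys.localQ x φ, ψ⟫_ℂ = ⟪φ, sys.localQadj x ψ⟫_ℂ := by
  simp only [localQ, localQadj, _root_.sum_apply, sum_inner, inner_sum]
  exact Finset.sum_congr rfl fun y _ => sys.inner_oPlus_left y φ ψ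

/-- `‖[Q_x, Q_x^*]‖ ≤ 8 o² N`: by i) the commutator is `Σ_{y ∉ S_x} [o⁺_y, o⁻_y]`.
[cite: KomaTasaki1994, §4] -/
theorem norm_comm_localQ_le [DecidableEq Λ] (x : Λ) :
    ‖sys.localQ x * sys.localQadj x - sys.localQadj x * sys.localQ x‖ ≤
      8 * sys.obar ^ 2 * Fintype.card Λ := by
  rw [localQ, localQadj, sum_mul_sum_sub_sum_mul_sum _ _ _
    (fun y _ z _ hyz => (sys.commute_oPlus_oMinus hyz).eq)]
  calc ‖∑ y ∈ (sys.supp x)ᶜ, (sys.oPlus y * sys.oMinus y - sys.oMinus y * sys.oPlus y)‖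
      ≤ ∑ y ∈ (sys.supp x)ᶜ, ‖sys.oPlus y * sys.oMinus y - sys.oMinus y * sys.oPlus y‖ :=
        norm_sum_le _ _
    _ ≤ ∑ _y ∈ (sys.supp x)ᶜ, 8 * sys.obar ^ 2 := by
        refine Finset.sum_le_sum fun y _ => ?_
        calc ‖sys.oPlus y * sys.oMinus y - sys.oMinus y * sys.oPlus y‖
            ≤ 2 * ‖sys.oPlus y‖ * ‖sys.oMinus y‖ := norm_comm_le _ _
          _ ≤ 2 * (2 * sys.obar) * (2 * sys.obar) := by
              have := sys.norm_oPlus_le y; have := sys.norm_oMinus_le y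
              have : 0 ≤ sys.obar := sys.obar_pos.le
              gcongr
          _ = 8 * sys.obar ^ 2 := by ring
    _ = ((sys.supp x)ᶜ.card : ℝ) * (8 * sys.obar ^ 2) := by rw [Finset.sum_const, nsmul_eq_mul]
    _ ≤ (Fintype.card Λ : ℝ) * (8 * sys.obar ^ 2) := by
        have h1 : (((sys.supp x)ᶜ).card : ℝ) ≤ Fintype.card Λ := by
          exact_mod_cast Finset.card_le_univ _
        have h2 : 0 ≤ 8 * sys.obar ^ 2 := by positivity
        exact mul_le_mul_of_nonneg_right h1 h2
    _ = 8 * sys.obar ^ 2 * Fintype.card Λ := by ring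

/-- `‖[O^{(1)}, O^{(2)}]‖ ≤ 2 o² N`: by i) the commutator is `Σ_y [o^{(1)}_y, o^{(2)}_y]`.
[cite: KomaTasaki1994, §4] -/
theorem norm_comm_order_le :
    ‖sys.order 0 * sys.order 1 - sys.order 1 * sys.order 0‖ ≤
      2 * sys.obar ^ 2 * Fintype.card Λ := by
  rw [order, order, sum_mul_sum_sub_sum_mul_sum _ _ _
    (fun y _ z _ hyz => (sys.commute_o y z hyz 0 1).eq)]
  calc ‖∑ y, (sys.o 0 y * sys.o 1 y - sys.o 1 y * sys.o 0 y)‖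
      ≤ ∑ y, ‖sys.o 0 y * sys.o 1 y - sys.o 1 y * sys.o 0 y‖ := norm_sum_le _ _
    _ ≤ ∑ _y : Λ, 2 * sys.obar ^ 2 := by
        refine Finset.sum_le_sum fun y _ => ?_
        calc ‖sys.o 0 y * sys.o 1 y - sys.o 1 y * sys.o 0 y‖
            ≤ 2 * ‖sys.o 0 y‖ * ‖sys.o 1 y‖ := norm_comm_le _ _
          _ ≤ 2 * sys.obar * sys.obar := by
              have := sys.norm_o_le 0 y; have := sys.norm_o_le 1 y
              have : 0 ≤ sys.obar := sys.obar_pos.le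
              gcongr
          _ = 2 * sys.obar ^ 2 := by ring
    _ = 2 * sys.obar ^ 2 * Fintype.card Λ := by
        rw [Finset.sum_const, nsmul_eq_mul, Finset.card_univ]; ring

/-! ### Long-range order in both components and the bound on `a_1 = ‖Q_x Φ‖²` -/

/-- `‖O^{(1)} Φ‖² ≥ (μ o N)²` (from (2.17) and self-adjointness). [cite: KomaTasaki1994, (2.17)] -/
theorem sq_le_norm_sq_order_zero {Φ : E} {EΛ μ : ℝ} (hΦ : IsLROEigenstate sys Φ EΛ μ) :
    (μ * sys.obar * Fintype.card Λ) ^ 2 ≤ ‖sys.order 0 Φ‖ ^ 2 := by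
  have hsym : ⟪sys.order 0 Φ, sys.order 0 Φ⟫_ℂ = ⟪Φ, sys.order 0 (sys.order 0 Φ)⟫_ℂ :=
    sys.isSymmetric_order 0 Φ (sys.order 0 Φ)
  rw [norm_sq_eq_re_inner_self, hsym]
  exact hΦ.lro

/-- `‖O^{(2)} Φ‖² ≥ (μ o N)²` (from (2.17) and self-adjointness). [cite: KomaTasaki1994, (2.17)] -/
theorem sq_le_norm_sq_order_one {Φ : E} {EΛ μ : ℝ} (hΦ : IsLROEigenstate sys Φ EΛ μ) :
    (μ * sys.obar * Fintype.card Λ) ^ 2 ≤ ‖sys.order 1 Φ‖ ^ 2 := by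
  have hsym : ⟪sys.order 1 Φ, sys.order 1 Φ⟫_ℂ = ⟪Φ, sys.order 1 (sys.order 1 Φ)⟫_ℂ :=
    sys.isSymmetric_order 1 Φ (sys.order 1 Φ)
  rw [norm_sq_eq_re_inner_self, hsym, ← hΦ.lro_eq]
  exact hΦ.lro

/-- `‖O⁺ Φ‖² ≥ ‖O^{(1)} Φ‖² + ‖O^{(2)} Φ‖² - ‖[O^{(1)}, O^{(2)}]‖` for a unit vector `Φ`
(KT §4, the step `⟨O⁻O⁺⟩ = ½{⟨O⁻O⁺⟩ + ⟨O⁺O⁻⟩ + ⟨[O⁻, O⁺]⟩}` in the bound on `a_1`).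
[cite: KomaTasaki1994, §4] -/
theorem norm_sq_orderPlus_apply_ge {Φ : E} (hΦ1 : ‖Φ‖ = 1) :
    ‖sys.order 0 Φ‖ ^ 2 + ‖sys.order 1 Φ‖ ^ 2 - 2 * sys.obar ^ 2 * Fintype.card Λ ≤
      ‖sys.orderPlus Φ‖ ^ 2 := by
  set z : ℂ := ⟪sys.order 0 Φ, sys.order 1 Φ⟫_ℂ with hz
  have hexp : ‖sys.orderPlus Φ‖ ^ 2 =
      ‖sys.order 0 Φ‖ ^ 2 - 2 * z.im + ‖sys.order 1 Φ‖ ^ 2 := by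
    rw [orderPlus, _root_.add_apply, _root_.smul_apply, norm_add_sq (𝕜 := ℂ), norm_smul,
      Complex.norm_I, one_mul, inner_smul_right, RCLike.re_to_complex, Complex.mul_re,
      Complex.I_re, Complex.I_im, ← hz]
    ring
  set D : E →L[ℂ] E := sys.order 0 * sys.order 1 - sys.order 1 * sys.order 0 with hD
  have h0 : ⟪sys.order 0 Φ, sys.order 1 Φ⟫_ℂ = ⟪Φ, sys.order 0 (sys.order 1 Φ)⟫_ℂ :=
    sys.isSymmetric_order 0 Φ (sys.order 1 Φ)
  have h1 : ⟪sys.order 1 Φ, sys.order 0 Φ⟫_ℂ = ⟪Φ, sys.order 1 (sys.order 0 Φ)⟫_ℂ :=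
    sys.isSymmetric_order 1 Φ (sys.order 0 Φ)
  have h1' : ⟪sys.order 1 Φ, sys.order 0 Φ⟫_ℂ = conj z := by
    rw [hz, inner_conj_symm]
  have hcomm : ⟪Φ, D Φ⟫_ℂ = z - conj z := by
    simp only [hD, _root_.sub_apply, mul_apply_eq_comp, inner_sub_right, ← h0, ← h1, h1', hz]
  have him : (⟪Φ, D Φ⟫_ℂ).im = 2 * z.im := by
    rw [hcomm, Complex.sub_im, Complex.conj_im]; ring
  have hbound : |2 * z.im| ≤ 2 * sys.obar ^ 2 * Fintype.card Λ := by
    rw [← him]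
    calc |(⟪Φ, D Φ⟫_ℂ).im| ≤ ‖⟪Φ, D Φ⟫_ℂ‖ := Complex.abs_im_le_norm _
      _ ≤ ‖D‖ * ‖Φ‖ ^ 2 := norm_inner_apply_le D Φ
      _ = ‖D‖ := by rw [hΦ1]; ring
      _ ≤ 2 * sys.obar ^ 2 * Fintype.card Λ := sys.norm_comm_order_le
  rw [hexp]
  have := (abs_le.1 hbound).2
  linarith

/-- KT §4, the bound (a1Bound) on `a_1 = ‖Q_x Φ‖²`:
`a_1 ≥ 2(μ o N)² - 2 o² N - 8 o² r N` (from (2.17) in both components, i) and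
`‖O⁺ Φ‖ ≤ 2 o N`, `‖R_x Φ‖ ≤ 2 o r`). [cite: KomaTasaki1994, §4 Lemma 4.1] -/
theorem norm_sq_localQ_apply_ge [DecidableEq Λ] {Φ : E} {EΛ μ : ℝ}
    (hΦ : IsLROEigenstate sys Φ EΛ μ) (x : Λ) :
    2 * (μ * sys.obar * Fintype.card Λ) ^ 2 - 2 * sys.obar ^ 2 * Fintype.card Λ -
        8 * sys.obar ^ 2 * sys.r * Fintype.card Λ ≤ ‖sys.localQ x Φ‖ ^ 2 := by
  have hQ : sys.localQ x Φ = sys.orderPlus Φ - sys.localR x Φ := by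
    rw [sys.orderPlus_eq_localR_add_localQ x, _root_.add_apply]; abel
  have h1 : ‖sys.orderPlus Φ‖ ≤ 2 * sys.obar * Fintype.card Λ :=
    calc ‖sys.orderPlus Φ‖ ≤ ‖sys.orderPlus‖ * ‖Φ‖ := sys.orderPlus.le_opNorm Φ
      _ = ‖sys.orderPlus‖ := by rw [hΦ.norm_eq_one, mul_one]
      _ ≤ 2 * sys.obar * Fintype.card Λ := sys.norm_orderPlus_le
  have h2 : ‖sys.localR x Φ‖ ≤ 2 * sys.obar * sys.r :=
    calc ‖sys.localR x Φ‖ ≤ ‖sys.localR x‖ * ‖Φ‖ := (sys.localR x).le_opNorm Φ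
      _ = ‖sys.localR x‖ := by rw [hΦ.norm_eq_one, mul_one]
      _ ≤ 2 * sys.obar * sys.r := sys.norm_localR_le x
  have hre : 2 * (⟪sys.orderPlus Φ, sys.localR x Φ⟫_ℂ).re ≤
      8 * sys.obar ^ 2 * sys.r * Fintype.card Λ :=
    calc 2 * (⟪sys.orderPlus Φ, sys.localR x Φ⟫_ℂ).re
        ≤ 2 * (‖sys.orderPlus Φ‖ * ‖sys.localR x Φ‖) := by
          have := re_inner_le_norm (𝕜 := ℂ) (sys.orderPlus Φ) (sys.localR x Φ)
          rw [RCLike.re_to_complex] at this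
          linarith
      _ ≤ 2 * ((2 * sys.obar * Fintype.card Λ) * (2 * sys.obar * sys.r)) := by
          have : 0 ≤ 2 * sys.obar * Fintype.card Λ := by have := sys.obar_pos; positivity
          gcongr
      _ = 8 * sys.obar ^ 2 * sys.r * Fintype.card Λ := by ring
  have h0 := sys.sq_le_norm_sq_order_zero hΦ
  have h1' := sys.sq_le_norm_sq_order_one hΦ
  have hP := sys.norm_sq_orderPlus_apply_ge hΦ.norm_eq_one
  have hsq : ‖sys.localQ x Φ‖ ^ 2 = ‖sys.orderPlus Φ‖ ^ 2 -
      2 * (⟪sys.orderPlus Φ, sys.localR x Φ⟫_ℂ).re + ‖sys.localR x Φ‖ ^ 2 := by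
    rw [hQ, norm_sub_sq (𝕜 := ℂ), RCLike.re_to_complex]
  rw [hsq]
  nlinarith [sq_nonneg ‖sys.localR x Φ‖]

end U1System

/-! ### The growth lemma (KT §4, Lemma 4.1) -/

section Growth

omit [Fintype Λ]

/-- KT §4, proof of Lemma 4.1, the Cauchy–Schwarz step ((am-1)):
`a_{j+1}² ≤ a_j (a_{j+2} + K a_{j+1})` for `a_j = ‖Q^j Φ‖²`, `Q^*` the adjoint of `Q` and
`K ≥ ‖[Q, Q^*]‖`. [cite: KomaTasaki1994, §4 Lemma 4.1] -/
theorem growth_step (Q Qm : E →L[ℂ] E) (hadj : ∀ φ ψ : E, ⟪Q φ, ψ⟫_ℂ = ⟪φ, Qm ψ⟫_ℂ)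
    {K : ℝ} (hK : ‖Q * Qm - Qm * Q‖ ≤ K) (Φ : E) (j : ℕ) :
    (‖(Q ^ (j + 1)) Φ‖ ^ 2) ^ 2 ≤
      ‖(Q ^ j) Φ‖ ^ 2 * (‖(Q ^ (j + 2)) Φ‖ ^ 2 + K * ‖(Q ^ (j + 1)) Φ‖ ^ 2) := by
  set w : E := (Q ^ j) Φ with hw
  set v : E := (Q ^ (j + 1)) Φ with hv
  have hvw : v = Q w := by rw [hv, hw, pow_succ', mul_apply_eq_comp]
  have hQv : (Q ^ (j + 2)) Φ = Q v := by rw [hv, pow_succ' Q (j + 1), mul_apply_eq_comp]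
  have hadj' : ∀ φ ψ : E, ⟪Qm φ, ψ⟫_ℂ = ⟪φ, Q ψ⟫_ℂ := by
    intro φ ψ
    rw [← inner_conj_symm, ← hadj, inner_conj_symm]
  -- `‖v‖² = ⟨Q w, v⟩ = ⟨w, Q^* v⟩ ≤ ‖w‖ ‖Q^* v‖`
  have h1 : ‖v‖ ^ 2 ≤ ‖w‖ * ‖Qm v‖ := by
    have e : ⟪v, v⟫_ℂ = ⟪w, Qm v⟫_ℂ := by
      calc ⟪v, v⟫_ℂ = ⟪Q w, v⟫_ℂ := by rw [← hvw]
        _ = ⟪w, Qm v⟫_ℂ := hadj w v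
    rw [norm_sq_eq_re_inner_self, e]
    have := re_inner_le_norm (𝕜 := ℂ) w (Qm v)
    rwa [RCLike.re_to_complex] at this
  -- `‖Q^* v‖² = ⟨v, Q Q^* v⟩ = ‖Q v‖² + ⟨v, [Q, Q^*] v⟩ ≤ ‖Q v‖² + K ‖v‖²`
  have h2 : ‖Qm v‖ ^ 2 ≤ ‖Q v‖ ^ 2 + K * ‖v‖ ^ 2 := by
    have e1 : ⟪Qm v, Qm v⟫_ℂ = ⟪v, Q (Qm v)⟫_ℂ := hadj' v (Qm v)
    have e2 : Q (Qm v) = Qm (Q v) + (Q * Qm - Qm * Q) v := by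
      simp only [_root_.sub_apply, mul_apply_eq_comp]; abel
    have e3 : ⟪v, Qm (Q v)⟫_ℂ = ⟪Q v, Q v⟫_ℂ := (hadj v (Q v)).symm
    rw [norm_sq_eq_re_inner_self (Qm v), e1, e2, inner_add_right, e3, Complex.add_re,
      ← norm_sq_eq_re_inner_self]
    have : (⟪v, (Q * Qm - Qm * Q) v⟫_ℂ).re ≤ K * ‖v‖ ^ 2 :=
      calc (⟪v, (Q * Qm - Qm * Q) v⟫_ℂ).re ≤ ‖⟪v, (Q * Qm - Qm * Q) v⟫_ℂ‖ :=
            Complex.re_le_norm _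
        _ ≤ ‖Q * Qm - Qm * Q‖ * ‖v‖ ^ 2 := norm_inner_apply_le _ _
        _ ≤ K * ‖v‖ ^ 2 := by gcongr
    linarith
  rw [hQv]
  have h1' : (‖v‖ ^ 2) ^ 2 ≤ ‖w‖ ^ 2 * ‖Qm v‖ ^ 2 := by
    rw [← mul_pow]; exact pow_le_pow_left₀ (by positivity) h1 2
  calc (‖v‖ ^ 2) ^ 2 ≤ ‖w‖ ^ 2 * ‖Qm v‖ ^ 2 := h1'
    _ ≤ ‖w‖ ^ 2 * (‖Q v‖ ^ 2 + K * ‖v‖ ^ 2) := by gcongr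

/-- **KT §4, Lemma 4.1** (QQLemma), abstract form: if `Q^*` is the adjoint of `Q`,
`‖[Q, Q^*]‖ ≤ K`, `‖Φ‖ = 1` and `a_1 = ‖Q Φ‖² ≥ s² + K M`, then `‖Q^{m+1} Φ‖ ≥ s ‖Q^m Φ‖`
for all `m < M` (KT: `a_m / a_{m-1} ≥ (μ o N)²`, by summing the recursion
`a_m/a_{m-1} ≥ a_{m-1}/a_{m-2} - K`; the printed sum has `m - 2` copies of `K` where `m - 1`
is meant — immaterial, and here the hypothesis is taken with `K M`).
[cite: KomaTasaki1994, §4 Lemma 4.1] -/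
theorem growth (Q Qm : E →L[ℂ] E) (hadj : ∀ φ ψ : E, ⟪Q φ, ψ⟫_ℂ = ⟪φ, Qm ψ⟫_ℂ)
    {K s : ℝ} (hK : ‖Q * Qm - Qm * Q‖ ≤ K) (hs : 0 < s) {Φ : E} (hΦ : ‖Φ‖ = 1) {M : ℕ}
    (h1 : s ^ 2 + K * M ≤ ‖Q Φ‖ ^ 2) {m : ℕ} (hm : m < M) :
    s * ‖(Q ^ m) Φ‖ ≤ ‖(Q ^ (m + 1)) Φ‖ := by
  have hK0 : 0 ≤ K := (norm_nonneg _).trans hK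
  set a : ℕ → ℝ := fun j => ‖(Q ^ j) Φ‖ ^ 2 with ha
  have ha0 : a 0 = 1 := by simp [ha, hΦ]
  have ha1 : a 1 = ‖Q Φ‖ ^ 2 := by simp [ha]
  have hstep : ∀ j, a (j + 1) ^ 2 ≤ a j * (a (j + 2) + K * a (j + 1)) := fun j =>
    growth_step Q Qm hadj hK Φ j
  have key : ∀ j, j < M → (a 1 - K * j) * a j ≤ a (j + 1) ∧ 0 < a j := by
    intro j
    induction j with
    | zero =>
      intro _
      refine ⟨by simp [ha0], by rw [ha0]; exact one_pos⟩
    | succ j ih =>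
      intro hj
      obtain ⟨ih1, ih2⟩ := ih (Nat.lt_of_succ_lt hj)
      have hjM : (j : ℝ) ≤ M := by exact_mod_cast (Nat.lt_of_succ_lt hj).le
      have hc : s ^ 2 ≤ a 1 - K * j := by nlinarith [h1, hjM, hK0]
      have hcpos : 0 < a 1 - K * j := lt_of_lt_of_le (pow_pos hs 2) hc
      have hapos : 0 < a (j + 1) := lt_of_lt_of_le (mul_pos hcpos ih2) ih1
      refine ⟨?_, hapos⟩
      have hnn : 0 ≤ a (j + 2) + K * a (j + 1) := by
        have : 0 ≤ a (j + 2) := sq_nonneg _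
        nlinarith [hapos.le, hK0]
      have h3 : (a 1 - K * j) * a (j + 1) ^ 2 ≤ a (j + 1) * (a (j + 2) + K * a (j + 1)) :=
        calc (a 1 - K * j) * a (j + 1) ^ 2
            ≤ (a 1 - K * j) * (a j * (a (j + 2) + K * a (j + 1))) :=
              mul_le_mul_of_nonneg_left (hstep j) hcpos.le
          _ = ((a 1 - K * j) * a j) * (a (j + 2) + K * a (j + 1)) := by ring
          _ ≤ a (j + 1) * (a (j + 2) + K * a (j + 1)) := mul_le_mul_of_nonneg_right ih1 hnn
      have h4 : (a 1 - K * j) * a (j + 1) ≤ a (j + 2) + K * a (j + 1) := by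
        have h3' : (a 1 - K * j) * a (j + 1) * a (j + 1) ≤
            (a (j + 2) + K * a (j + 1)) * a (j + 1) := by nlinarith [h3]
        exact le_of_mul_le_mul_right h3' hapos
      push_cast
      nlinarith [h4]
  obtain ⟨k1, k2⟩ := key m hm
  have hmM : (m : ℝ) ≤ M := by exact_mod_cast hm.le
  have hc : s ^ 2 ≤ a 1 - K * m := by nlinarith [h1, hmM, hK0]
  have h5 : s ^ 2 * a m ≤ a (m + 1) := le_trans (mul_le_mul_of_nonneg_right hc k2.le) k1
  have h6 : (s * ‖(Q ^ m) Φ‖) ^ 2 ≤ ‖(Q ^ (m + 1)) Φ‖ ^ 2 := by rw [mul_pow]; exact h5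
  exact (sq_le_sq₀ (by positivity) (norm_nonneg _)).1 h6

/-- Iterated growth bound (KT (QQBound)): `s^k ‖Q^{M-k} Φ‖ ≤ ‖Q^M Φ‖` for `k ≤ M`.
[cite: KomaTasaki1994, §4 Lemma 4.1] -/
theorem growth_iter (Q Qm : E →L[ℂ] E) (hadj : ∀ φ ψ : E, ⟪Q φ, ψ⟫_ℂ = ⟪φ, Qm ψ⟫_ℂ)
    {K s : ℝ} (hK : ‖Q * Qm - Qm * Q‖ ≤ K) (hs : 0 < s) {Φ : E} (hΦ : ‖Φ‖ = 1) {M : ℕ}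
    (h1 : s ^ 2 + K * M ≤ ‖Q Φ‖ ^ 2) {k : ℕ} (hk : k ≤ M) :
    s ^ k * ‖(Q ^ (M - k)) Φ‖ ≤ ‖(Q ^ M) Φ‖ := by
  induction k with
  | zero => simp
  | succ k ih =>
    have hk' : k ≤ M := Nat.le_of_succ_le hk
    have hm : M - (k + 1) < M := by omega
    have e : M - (k + 1) + 1 = M - k := by omega
    have hg := growth Q Qm hadj hK hs hΦ h1 hm
    rw [e] at hg
    calc s ^ (k + 1) * ‖(Q ^ (M - (k + 1))) Φ‖ = s ^ k * (s * ‖(Q ^ (M - (k + 1))) Φ‖) := by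
          ring
      _ ≤ s ^ k * ‖(Q ^ (M - k)) Φ‖ := by gcongr
      _ ≤ ‖(Q ^ M) Φ‖ := ih hk'

/-- The tail of the binomial expansion (KT §4, use of (OExp) with (QQBound)): if
`‖T_k‖ ≤ C ρ^k` for `1 ≤ k ≤ M` and `s^k ‖Q^{M-k} Φ‖ ≤ ‖Q^M Φ‖` for `k ≤ M`, then
`‖Σ_{k<M} C(M,k+1) T_{k+1} Q^{M-k-1} Φ‖ ≤ C ‖Q^M Φ‖ ((1 + ρ/s)^M - 1)`.
[cite: KomaTasaki1994, §4] -/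
theorem norm_binomial_tail_le (Q : E →L[ℂ] E) (T : ℕ → E →L[ℂ] E) (Φ : E) (M : ℕ)
    {ρ s C : ℝ} (hρ : 0 ≤ ρ) (hs : 0 < s) (hC : 0 ≤ C)
    (hT : ∀ k, 1 ≤ k → k ≤ M → ‖T k‖ ≤ C * ρ ^ k)
    (hgrow : ∀ k, k ≤ M → s ^ k * ‖(Q ^ (M - k)) Φ‖ ≤ ‖(Q ^ M) Φ‖) :
    ‖∑ k ∈ Finset.range M, (M.choose (k + 1) : ℂ) • T (k + 1) ((Q ^ (M - (k + 1))) Φ)‖ ≤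
      C * ‖(Q ^ M) Φ‖ * ((1 + ρ / s) ^ M - 1) := by
  have hbinom : ∑ k ∈ Finset.range M, (M.choose (k + 1) : ℝ) * (ρ / s) ^ (k + 1) =
      (1 + ρ / s) ^ M - 1 := by
    rw [add_comm (1 : ℝ), add_pow, Finset.sum_range_succ']
    simp only [one_pow, mul_one, pow_zero, Nat.choose_zero_right, Nat.cast_one,
      add_sub_cancel_right]
    exact Finset.sum_congr rfl fun k _ => mul_comm _ _
  calc ‖∑ k ∈ Finset.range M, (M.choose (k + 1) : ℂ) • T (k + 1) ((Q ^ (M - (k + 1))) Φ)‖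
      ≤ ∑ k ∈ Finset.range M, ‖(M.choose (k + 1) : ℂ) • T (k + 1) ((Q ^ (M - (k + 1))) Φ)‖ :=
        norm_sum_le _ _
    _ ≤ ∑ k ∈ Finset.range M, C * ‖(Q ^ M) Φ‖ * ((M.choose (k + 1) : ℝ) * (ρ / s) ^ (k + 1)) := by
        refine Finset.sum_le_sum fun k hk => ?_
        have hk1 : k + 1 ≤ M := by rw [Finset.mem_range] at hk; omega
        rw [norm_smul, Complex.norm_natCast]
        have hTk := hT (k + 1) (by omega) hk1
        have hq : ‖(Q ^ (M - (k + 1))) Φ‖ ≤ ‖(Q ^ M) Φ‖ / s ^ (k + 1) := by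
          rw [le_div_iff₀ (pow_pos hs _), mul_comm]; exact hgrow (k + 1) hk1
        calc (M.choose (k + 1) : ℝ) * ‖T (k + 1) ((Q ^ (M - (k + 1))) Φ)‖
            ≤ (M.choose (k + 1) : ℝ) * (‖T (k + 1)‖ * ‖(Q ^ (M - (k + 1))) Φ‖) := by
              gcongr; exact (T (k + 1)).le_opNorm _
          _ ≤ (M.choose (k + 1) : ℝ) * ((C * ρ ^ (k + 1)) * (‖(Q ^ M) Φ‖ / s ^ (k + 1))) := by
              gcongr
          _ = C * ‖(Q ^ M) Φ‖ * ((M.choose (k + 1) : ℝ) * (ρ / s) ^ (k + 1)) := by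
              rw [div_pow]; field_simp
    _ = C * ‖(Q ^ M) Φ‖ * ((1 + ρ / s) ^ M - 1) := by rw [← Finset.mul_sum, hbinom]

end Growth

/-! ### Theorem 2.3 for positive `M` -/

/-- **KT Theorem 2.3 for `M ≥ 1`**, with the size conditions (2.20) `N ≥ (4r/μ)²` and (2.21)
`M ≤ (μ²/(8r)) N` written multiplied out: `(O⁺)^M Φ ≠ 0` and, for `Ψ = (O⁺)^M Φ / ‖(O⁺)^M Φ‖`,
`|⟨Ψ, H Ψ⟩ - E| ≤ (8 h r / μ) M`. [cite: KomaTasaki1994, Theorem 2.3 (2.20)–(2.22), §4] -/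
theorem theorem_2_3_pos (sys : U1System Λ E) {Φ : E} {EΛ μ : ℝ}
    (hΦ : IsLROEigenstate sys Φ EΛ μ) (hN : 16 * (sys.r : ℝ) ^ 2 ≤ μ ^ 2 * Fintype.card Λ)
    {M : ℕ} (hM1 : 1 ≤ M) (hM : 8 * sys.r * (M : ℝ) ≤ μ ^ 2 * Fintype.card Λ) :
    (sys.orderPlus ^ M) Φ ≠ 0 ∧
      |(⟪(‖(sys.orderPlus ^ M) Φ‖⁻¹ : ℂ) • (sys.orderPlus ^ M) Φ,
          sys.hamiltonian ((‖(sys.orderPlus ^ M) Φ‖⁻¹ : ℂ) • (sys.orderPlus ^ M) Φ)⟫_ℂ).re - EΛ| ≤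
        8 * sys.hbar * sys.r / μ * M := by
  classical
  -- positivity bookkeeping
  have hμ : 0 < μ := hΦ.mu_pos
  have hμ1 : μ ≤ 1 := hΦ.mu_le_one
  have ho : 0 < sys.obar := sys.obar_pos
  have hr : (2 : ℝ) ≤ sys.r := by exact_mod_cast sys.two_le_r
  have hM1' : (1 : ℝ) ≤ M := by exact_mod_cast hM1
  set N : ℝ := (Fintype.card Λ : ℝ) with hNdef
  have hr0 : (0 : ℝ) < sys.r := by linarith only [hr]
  have hμN : 0 < μ ^ 2 * N := lt_of_lt_of_le (by positivity) hN
  have hNpos : 0 < N := by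
    by_contra hle
    have hle' : μ ^ 2 * N ≤ 0 := mul_nonpos_of_nonneg_of_nonpos (sq_nonneg μ) (not_lt.mp hle)
    linarith only [hle', hμN]
  haveI : Nonempty Λ := by
    have hc : 0 < Fintype.card Λ := by
      have h := hNpos
      rw [hNdef] at h
      exact_mod_cast h
    exact Fintype.card_pos_iff.mp hc
  have hh : 0 ≤ sys.hbar := (norm_nonneg _).trans (sys.norm_h_le (Classical.arbitrary Λ))
  -- the arithmetic content of (2.20)–(2.21): `8 r + 2 + 8 M ≤ μ² N`
  have harith : 8 * (sys.r : ℝ) + 2 + 8 * M ≤ μ ^ 2 * N := by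
    have h1 : 0 ≤ ((sys.r : ℝ) - 2) * M := mul_nonneg (by linarith only [hr]) (by linarith only [hM1'])
    have h2 : 0 ≤ ((sys.r : ℝ) - 2) ^ 2 := sq_nonneg _
    nlinarith only [hN, hM, hr, hM1', h1, h2]
  -- constants
  set s : ℝ := μ * sys.obar * N with hsdef
  have hs : 0 < s := by positivity
  set ρ : ℝ := 2 * sys.obar * sys.r with hρdef
  have hρ : 0 ≤ ρ := by positivity
  set K : ℝ := 8 * sys.obar ^ 2 * N with hKdef
  set τ : ℝ := (M : ℝ) * (ρ / s) with hτdef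
  have hτ : τ = 2 * sys.r * M / (μ * N) := by
    rw [hτdef, hρdef, hsdef]; field_simp
  have hτle : τ ≤ 1 / 4 := by
    rw [hτ, div_le_iff₀ (by positivity)]
    have h1 : μ * (μ * N) ≤ μ * N := mul_le_of_le_one_left (by positivity) hμ1
    nlinarith only [hM, h1]
  have hτ0 : 0 ≤ τ := by positivity
  -- `u = (1 + ρ/s)^M` and Bernoulli's inequality
  set u : ℝ := (1 + ρ / s) ^ M with hudef
  have hts : 0 ≤ ρ / s := by positivity
  have ht1 : ρ / s ≤ 1 / 4 := le_trans (le_mul_of_one_le_left hts hM1') hτle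
  have hu1 : 1 ≤ u := one_le_pow₀ (by linarith)
  have hu : u * (1 - τ) ≤ 1 := by
    have hB : 1 - τ ≤ (1 - ρ / s) ^ M := by
      have h' := one_add_mul_le_pow (show (-2 : ℝ) ≤ -(ρ / s) by linarith only [ht1]) M
      have e1 : (1 : ℝ) + (M : ℝ) * -(ρ / s) = 1 - τ := by rw [hτdef]; ring
      have e2 : (1 : ℝ) + -(ρ / s) = 1 - ρ / s := by ring
      rw [e1, e2] at h'
      exact h'
    have hprod : u * (1 - ρ / s) ^ M ≤ 1 := by
      rw [hudef, ← mul_pow]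
      exact pow_le_one₀ (by nlinarith) (by nlinarith)
    calc u * (1 - τ) ≤ u * (1 - ρ / s) ^ M := mul_le_mul_of_nonneg_left hB (by positivity)
      _ ≤ 1 := hprod
  have hu0 : 0 ≤ u := by linarith only [hu1]
  have hu43 : u ≤ 4 / 3 := by
    have h1 : 0 ≤ u * (1 / 4 - τ) := mul_nonneg hu0 (by linarith only [hτle])
    nlinarith only [hu, h1]
  have hum1 : u - 1 ≤ 4 / 3 * τ := by
    have h1 : 0 ≤ (4 / 3 - u) * τ := mul_nonneg (by linarith only [hu43]) hτ0
    nlinarith only [hu, h1]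
  -- the main objects
  set P : E →L[ℂ] E := sys.orderPlus with hP
  set ψ : E := (P ^ M) Φ with hψ
  -- per-site estimates (KT §4: (OExp), (QQBound), (OhO2), (OOQQ))
  have hsite : ∀ x : Λ,
      ‖(sys.localQ x ^ M) Φ‖ * (2 - u) ≤ ‖ψ‖ ∧
      ‖sys.h x ψ - (P ^ M) (sys.h x Φ)‖ ≤ 2 * sys.hbar * ‖(sys.localQ x ^ M) Φ‖ * (u - 1) ∧
      0 < ‖(sys.localQ x ^ M) Φ‖ := by
    intro x
    set Q : E →L[ℂ] E := sys.localQ x with hQ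
    set R : E →L[ℂ] E := sys.localR x with hR
    have hPQR : P = R + Q := sys.orderPlus_eq_localR_add_localQ x
    have hRQ : Commute R Q := sys.commute_localR_localQ x
    have hRn : ‖R‖ ≤ ρ := sys.norm_localR_le x
    have hhQ : Commute (sys.h x) Q := sys.commute_h_localQ x
    -- growth
    have hadj : ∀ φ ψ : E, ⟪Q φ, ψ⟫_ℂ = ⟪φ, sys.localQadj x ψ⟫_ℂ := sys.inner_localQ_left x
    have hKQ : ‖Q * sys.localQadj x - sys.localQadj x * Q‖ ≤ K := sys.norm_comm_localQ_le x
    have ha1 : s ^ 2 + K * M ≤ ‖Q Φ‖ ^ 2 := by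
      have h0 := sys.norm_sq_localQ_apply_ge hΦ x
      have h2 : sys.obar ^ 2 * N * (8 * (sys.r : ℝ) + 2 + 8 * M) ≤
          sys.obar ^ 2 * N * (μ ^ 2 * N) :=
        mul_le_mul_of_nonneg_left harith (by positivity)
      have h3 : s ^ 2 = sys.obar ^ 2 * N * (μ ^ 2 * N) := by rw [hsdef]; ring
      rw [h3, hKdef]
      rw [← hNdef, ← hQ] at h0
      nlinarith only [h0, h2]
    have hgrow : ∀ k, k ≤ M → s ^ k * ‖(Q ^ (M - k)) Φ‖ ≤ ‖(Q ^ M) Φ‖ := fun k hk =>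
      growth_iter Q (sys.localQadj x) hadj hKQ hs hΦ.norm_eq_one ha1 hk
    have hnMpos : 0 < ‖(Q ^ M) Φ‖ := by
      have := hgrow M le_rfl
      simp only [Nat.sub_self, pow_zero, one_apply_eq_self, hΦ.norm_eq_one, mul_one] at this
      exact lt_of_lt_of_le (pow_pos hs M) this
    -- binomial expansion
    have hexp : P ^ M = ∑ m ∈ Finset.range (M + 1), (M.choose m : ℂ) • (R ^ m * Q ^ (M - m)) := by
      rw [hPQR, hRQ.add_pow]
      refine Finset.sum_congr rfl fun m _ => ?_
      rw [← nsmul_eq_mul', Nat.cast_smul_eq_nsmul]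
    have hexp_apply : ∀ v : E, (P ^ M) v =
        ∑ m ∈ Finset.range (M + 1), (M.choose m : ℂ) • (R ^ m) ((Q ^ (M - m)) v) := by
      intro v
      rw [hexp, _root_.sum_apply]
      simp only [_root_.smul_apply, mul_apply_eq_comp]
    -- (a) the tail `ψ - Q^M Φ`
    have htail : ψ - (Q ^ M) Φ = ∑ k ∈ Finset.range M,
        (M.choose (k + 1) : ℂ) • (R ^ (k + 1)) ((Q ^ (M - (k + 1))) Φ) := by
      rw [hψ, hexp_apply, Finset.sum_range_succ']
      simp
    have hRk : ∀ k, 1 ≤ k → k ≤ M → ‖R ^ k‖ ≤ 1 * ρ ^ k := fun k _ _ => by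
      rw [one_mul]; exact norm_pow_le_of_le hRn k
    have hA : ‖ψ - (Q ^ M) Φ‖ ≤ ‖(Q ^ M) Φ‖ * (u - 1) := by
      have := norm_binomial_tail_le Q (fun k => R ^ k) Φ M hρ hs zero_le_one hRk hgrow
      rw [← htail, one_mul] at this
      exact this
    -- (b) the commutator term `h_x ψ - (O⁺)^M h_x Φ`
    set T : ℕ → E →L[ℂ] E := fun k => sys.h x * R ^ k - R ^ k * sys.h x with hT
    have hTk : ∀ k, 1 ≤ k → k ≤ M → ‖T k‖ ≤ 2 * sys.hbar * ρ ^ k := fun k _ _ => by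
      calc ‖T k‖ ≤ 2 * ‖sys.h x‖ * ‖R ^ k‖ := norm_comm_le _ _
        _ ≤ 2 * sys.hbar * ρ ^ k := by
            have := sys.norm_h_le x
            have := norm_pow_le_of_le hRn k
            gcongr
    have hxi : sys.h x ψ - (P ^ M) (sys.h x Φ) = ∑ k ∈ Finset.range M,
        (M.choose (k + 1) : ℂ) • T (k + 1) ((Q ^ (M - (k + 1))) Φ) := by
      have hcomm : ∀ m : ℕ, (Q ^ m) (sys.h x Φ) = sys.h x ((Q ^ m) Φ) := fun m => by
        rw [← mul_apply_eq_comp, ← mul_apply_eq_comp, (hhQ.pow_right m).eq]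
      rw [hψ, hexp_apply, hexp_apply, map_sum, ← Finset.sum_sub_distrib,
        Finset.sum_range_succ']
      simp only [map_smul, hcomm, ← smul_sub, hT, _root_.sub_apply, mul_apply_eq_comp,
        pow_zero, one_apply_eq_self, sub_self, add_zero]
    have hB : ‖sys.h x ψ - (P ^ M) (sys.h x Φ)‖ ≤ 2 * sys.hbar * ‖(Q ^ M) Φ‖ * (u - 1) := by
      have := norm_binomial_tail_le Q T Φ M hρ hs (by positivity) hTk hgrow
      rw [← hxi] at this
      exact this
    refine ⟨?_, hB, hnMpos⟩
    have hC := norm_sub_norm_le ((Q ^ M) Φ) ψ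
    rw [norm_sub_rev] at hC
    have hD : ‖(Q ^ M) Φ‖ - ‖ψ‖ ≤ ‖(Q ^ M) Φ‖ * (u - 1) := hC.trans hA
    nlinarith only [hD]
  -- `ψ ≠ 0`
  obtain ⟨hx0, -, hx0pos⟩ := hsite (Classical.arbitrary Λ)
  have hψpos : 0 < ‖ψ‖ := by
    have h1 : 0 < ‖(sys.localQ (Classical.arbitrary Λ) ^ M) Φ‖ * (2 - u) :=
      mul_pos hx0pos (by linarith only [hu43])
    linarith only [h1, hx0]
  have hψne : ψ ≠ 0 := norm_pos_iff.mp hψpos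
  refine ⟨hψne, ?_⟩
  -- the energy identity `⟨ψ, Hψ⟩ - E‖ψ‖² = Σ_x ⟨ψ, h_x ψ - (O⁺)^M h_x Φ⟩`
  have hsumh : ∑ x, sys.h x ψ = sys.hamiltonian ψ := by
    rw [U1System.hamiltonian, _root_.sum_apply]
  have hsumP : ∑ x, (P ^ M) (sys.h x Φ) = (EΛ : ℂ) • ψ := by
    have : ∑ x, sys.h x Φ = sys.hamiltonian Φ := by rw [U1System.hamiltonian, _root_.sum_apply]
    rw [← map_sum, this, hΦ.eigen_hamiltonian, map_smul]
  have hHψ : sys.hamiltonian ψ - (EΛ : ℂ) • ψ = ∑ x, (sys.h x ψ - (P ^ M) (sys.h x Φ)) := by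
    rw [Finset.sum_sub_distrib, hsumh, hsumP]
  have hinner : ⟪ψ, sys.hamiltonian ψ⟫_ℂ - (EΛ : ℂ) * ⟪ψ, ψ⟫_ℂ =
      ∑ x, ⟪ψ, sys.h x ψ - (P ^ M) (sys.h x Φ)⟫_ℂ := by
    rw [← inner_sum, ← hHψ, inner_sub_right, inner_smul_right]
  have hbound : ‖⟪ψ, sys.hamiltonian ψ⟫_ℂ - (EΛ : ℂ) * ⟪ψ, ψ⟫_ℂ‖ ≤
      8 * sys.hbar * sys.r / μ * M * ‖ψ‖ ^ 2 := by
    rw [hinner]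
    calc ‖∑ x, ⟪ψ, sys.h x ψ - (P ^ M) (sys.h x Φ)⟫_ℂ‖
        ≤ ∑ x, ‖⟪ψ, sys.h x ψ - (P ^ M) (sys.h x Φ)⟫_ℂ‖ := norm_sum_le _ _
      _ ≤ ∑ x, ‖ψ‖ * ‖sys.h x ψ - (P ^ M) (sys.h x Φ)‖ :=
          Finset.sum_le_sum fun x _ => norm_inner_le_norm _ _
      _ ≤ ∑ _x : Λ, ‖ψ‖ * (4 * sys.hbar * τ * ‖ψ‖) := by
          refine Finset.sum_le_sum fun x _ => ?_
          obtain ⟨h1, h2, h3⟩ := hsite x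
          have hn : ‖(sys.localQ x ^ M) Φ‖ ≤ 3 / 2 * ‖ψ‖ := by
            have h4 : 0 ≤ (4 / 3 - u) * ‖(sys.localQ x ^ M) Φ‖ :=
              mul_nonneg (by linarith only [hu43]) h3.le
            nlinarith only [h1, h4]
          gcongr
          calc ‖sys.h x ψ - (P ^ M) (sys.h x Φ)‖
              ≤ 2 * sys.hbar * ‖(sys.localQ x ^ M) Φ‖ * (u - 1) := h2
            _ ≤ 2 * sys.hbar * (3 / 2 * ‖ψ‖) * (4 / 3 * τ) := by
                have : 0 ≤ u - 1 := by linarith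
                gcongr
            _ = 4 * sys.hbar * τ * ‖ψ‖ := by ring
      _ = N * (‖ψ‖ * (4 * sys.hbar * τ * ‖ψ‖)) := by
          rw [Finset.sum_const, Finset.card_univ, nsmul_eq_mul]
      _ = 8 * sys.hbar * sys.r / μ * M * ‖ψ‖ ^ 2 := by
          rw [hτ]; field_simp; ring
  -- conclusion
  rw [re_inner_normalize_apply]
  have hre : (⟪ψ, sys.hamiltonian ψ⟫_ℂ).re / ‖ψ‖ ^ 2 - EΛ =
      (⟪ψ, sys.hamiltonian ψ⟫_ℂ - (EΛ : ℂ) * ⟪ψ, ψ⟫_ℂ).re / ‖ψ‖ ^ 2 := by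
    rw [Complex.sub_re, Complex.re_ofReal_mul, ← norm_sq_eq_re_inner_self]
    field_simp
  rw [hre, abs_div, abs_of_pos (by positivity : (0 : ℝ) < ‖ψ‖ ^ 2),
    div_le_iff₀ (by positivity)]
  exact (Complex.abs_re_le_norm _).trans hbound

/-! ### Theorem 2.3 -/

/-- **KT Theorem 2.3 — PROVED.** The named fact `theorem_2_3` holds, with the constant
`c₁(h, r, μ) = 8 h r / μ`: for every `U(1)` system satisfying i)–iii), every `Φ, E, μ`
satisfying iv), `N ≥ (4r/μ)²` and `0 ≠ M ∈ ℤ` with `|M| ≤ (μ²/(8r)) N`, the vector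
`(O⁺)^M Φ` is nonzero and `|⟨Ψ^{(M)}, H Ψ^{(M)}⟩ - E| ≤ c₁ |M|`.  Positive `M`:
`theorem_2_3_pos`; negative `M`: the same for the mirror system (`O⁺_{mirror} = O⁻`).
[cite: KomaTasaki1994, Theorem 2.3 (2.20)–(2.22)] -/
theorem theorem_2_3_holds : theorem_2_3.{u, v} := by
  refine ⟨fun hbar r μ => 8 * hbar * r / μ, ?_⟩
  intro Λ _ E _ _ _ sys Φ EΛ μ hΦ hN M hM0 hM
  simp only [Int.cast_abs] at hM ⊢
  have hμ : 0 < μ := hΦ.mu_pos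
  have hr : (2 : ℝ) ≤ sys.r := by exact_mod_cast sys.two_le_r
  have hN' : 16 * (sys.r : ℝ) ^ 2 ≤ μ ^ 2 * Fintype.card Λ := by
    rw [div_pow, div_le_iff₀ (by positivity)] at hN
    linarith
  have hM' : 8 * sys.r * |(M : ℝ)| ≤ μ ^ 2 * Fintype.card Λ := by
    rw [div_mul_eq_mul_div, le_div_iff₀ (by positivity)] at hM
    linarith
  rcases lt_or_gt_of_ne hM0 with hneg | hpos
  · -- `M < 0`: the mirror system
    have hk : (((-M).toNat : ℕ) : ℝ) = |(M : ℝ)| := by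
      rw [abs_of_neg (by exact_mod_cast hneg)]
      have : (((-M).toNat : ℕ) : ℤ) = -M := Int.toNat_of_nonneg (by omega)
      exact_mod_cast this
    have hk1 : 1 ≤ (-M).toNat := by omega
    have h := theorem_2_3_pos (M := (-M).toNat) sys.mirror hΦ.mirror hN' hk1
      (by rw [hk]; exact hM')
    rw [U1System.mirror_orderPlus, U1System.mirror_hamiltonian, hk] at h
    unfold U1System.trialState
    rw [sys.orderPow_of_neg hneg]
    exact h
  · -- `M > 0`
    have hk : ((M.toNat : ℕ) : ℝ) = |(M : ℝ)| := by
      rw [abs_of_pos (by exact_mod_cast hpos)]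
      have : ((M.toNat : ℕ) : ℤ) = M := Int.toNat_of_nonneg hpos.le
      exact_mod_cast this
    have hk1 : 1 ≤ M.toNat := by omega
    have h := theorem_2_3_pos (M := M.toNat) sys hΦ hN' hk1 (by rw [hk]; exact hM')
    rw [hk] at h
    unfold U1System.trialState
    rw [sys.orderPow_of_nonneg hpos.le]
    exact h

end Literature.MathematicalPhysics.QuantumLattice.KomaTasaki
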